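import Summits.BirchSwinnertonDyer.BirchSwinnertonDyer.Theorems.KimAtThreeDeepLowerOffStratumLevelLoweringBridge
import Literature.NumberTheory.EllipticCurves.StabilisedLevelLoweringCongruence
import HarnessLib

/-!
# Route `KimAtThreeKolyvagin` (rung W2), crux `DeepLowerAtThreeOffKatoStratum` (item 19679), registered
# stub `stub_nonAdditive`: RE-KEY of the level-lowering binders to the Literature NAME
# `IsStabilisedLevelLoweringCongruence` (p464204), and the kernel COMPARISON with cell `b2b-bsdres`'s
# certificate — (LL_1) at `q ∣ N_E` IMPLIES `LevelLowering.PlusSymbolLevelLowersOver`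

Cell `bsd-addord`, seat `bsd-addord-w2-acc2` (PROGRAMME PART 1b, ACCEL-LIST row (2)), gen 2; item
`stmt-BirchSwinnertonDyer-19679`. Executes plan g17's call «ANSWER/LL_1 (1)» (2026-08-26T19:33:27Z): the
displayed congruence (LL_m) of the owner's road (`KimAtThreeDeepLowerTamagawaLevelLowering`, p459466 / p460203)
is carried under ONE registered predicate, the `bsd-litref` typer's
`Literature.NumberTheory.EllipticCurves.IsStabilisedLevelLoweringCongruence W p m f q` (+ `…In … π`, p464204),
and relates it IN THE KERNEL to the older, weaker typed input of cell `b2b-bsdres` (seat additive-p4, lines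
V39–V44): the certificate `Summit.BirchSwinnertonDyer.Rank1Residual.LevelLowering.PlusSymbolLevelLowersOver W p f ι ℓ`
(a `1`-periodic `k`-valued `μ`, `T_q`-eigen at the KOLYVAGIN primes only, with `ι([r]⁺_f mod p) = μ(r) − μ(ℓr)`),
whose provenance from mod-`p` multiplicity one + a non-zero `ℓ`-old eigensymbol is b2b's
`plusSymbolLevelLowersOver_of_multiplicityOne` (bridge to 19679: `KimAtThreeDeepLowerOffStratumLevelLoweringBridge`).
Theorems only; nothing asserted; the crux stays OPEN; BSD is not proved by any of this.

* §1 `plusSymbolLevelLowersOver_three_of_isStabilisedLevelLoweringCongruenceIn` — at `p = 3`, `m = 1`: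
  (LL_1) read in a non-trivial ring `k` through `π : ℤ/3 →+* k` (`IsStabilisedLevelLoweringCongruenceIn W 3 1 f q π`)
  IMPLIES the b2b certificate `PlusSymbolLevelLowersOver W 3 f π q` (`μ = u·φ`; the Hecke relations at ALL
  primes `ℓ ∤ 3N_E` restrict to the Kolyvagin primes; `ratModP 3 x = (x : ℤ/3)`). The converse is NOT
  claimed ((LL_1) asks Hecke relations at every good prime and allows `q ∣ 3N_E`). So every discharge of
  (LL_1) feeds b2b's consumers, and 19679's rows need only the WEAKER certificate.
* §2 the registered stub on its COVERED rows (ordinary if good, (ram) if multiplicative) and on its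
  SEMISTABLE rows, with `v₃(∏ c_ℓ) ≤ m`, from `IsStabilisedLevelLoweringCongruence W₀ 3 m D₀.f q` at any
  `q ∣ 3N_E` (re-key of gen 0 / this seat's `…_of_stabilisedCongruence`, one `obtain`), and — `m = 1`,
  `q ∣ N_E` — from the `k`-valued `…In … π` through §1 and the bridge.
[cite: GreenbergVatsal2000, §3 display (18)–(19)] [cite: Ribet1990, Thm. 1.1 and Thm. 5.2 (b)]
[cite: MazurTateTeitelbaum1986Invent, §I.4 (4.2) and §I.8] [cite: Kim2022StructureSelmer, §1.5.1, Conj. 1.10 (PDF pp. 7–8)]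
[cite: Kim2025RefinedTNC, §8.1.2] [cite: Skinner2016PacificMC, Thm. C (§1)] [cite: YanZhu2024MainConjNonCM, Thm. 4.15 (§4.6)]
[cite: Mazur1978, Cor. 4.1] [cite: Miller2011LMS, Def. 1.1]
-/


set_option autoImplicit false
-- the Theorems namespace of a single-conjunct summit repeats the summit name by design (D-0017)
set_option linter.dupNamespace false

noncomputable section

open scoped MatrixGroups ModularForm Classical

open CongruenceSubgroup WeierstrassCurve Literature.NumberTheory.EllipticCurves
  Literature.NumberTheory.EllipticCurves.ModularForms
  Literature.NumberTheory.EllipticCurves.Rank1Residual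
  Literature.NumberTheory.EllipticCurves.Rank1Residual.Typed
  Literature.NumberTheory.EllipticCurves.Skinner2016
  Literature.NumberTheory.Automorphic
  Summit.BirchSwinnertonDyer.BirchSwinnertonDyer.Theorems.Rank1ResidualX1Defs
open Literature.NumberTheory.DiophantineGeometry.Dioph (ratModP)

namespace Summit.BirchSwinnertonDyer.BirchSwinnertonDyer.Theorems.KimAtThreeDeepLowerOffStratumLevelLoweringRekey

open Summit.BirchSwinnertonDyer.Rank1Residual
open Summit.BirchSwinnertonDyer.Rank1Residual.LevelLowering
open Summit.BirchSwinnertonDyer.BirchSwinnertonDyer.Theses.KimAtThreeKolyvagin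
open Summit.BirchSwinnertonDyer.BirchSwinnertonDyer.Theorems.KimAtThreeDeepLowerSmallDefect
open Summit.BirchSwinnertonDyer.BirchSwinnertonDyer.Theorems.KimAtThreeDeepLowerNonAdditiveRows
open Summit.BirchSwinnertonDyer.BirchSwinnertonDyer.Theorems.KimAtThreeShallowEqDeepOffStratumNonAdditiveRows
open Summit.BirchSwinnertonDyer.BirchSwinnertonDyer.Theorems.KimAtThreeDeepLowerOffStratumSockets
open Summit.BirchSwinnertonDyer.BirchSwinnertonDyer.Theorems.KimAtThreeDeepLowerOffStratumNonAdditiveRows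
open Summit.BirchSwinnertonDyer.BirchSwinnertonDyer.Theorems.KimAtThreeDeepLowerTamagawaLevelLowering
open Summit.BirchSwinnertonDyer.BirchSwinnertonDyer.Theorems.KimAtThreeDeepLowerOffStratumSemistable
open Summit.BirchSwinnertonDyer.BirchSwinnertonDyer.Theorems.KimAtThreeDeepLowerOffStratumLevelLoweringBridge

/-! ### §1 (LL_1) at `q ∣ N_E` implies the b2b certificate -/

section Comparison

variable {k : Type*} [CommRing k]

omit [CommRing k] in
/-- `1`-periodicity in b2b's form (`μ(r + z) = μ(r)`, `z ∈ ℤ`) from the consumers' form `φ(x + 1) = φ(x)`.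
[folklore] -/
theorem isPeriodic_of_forall_add_one {φ : ℚ → k} (hper : ∀ x, φ (x + 1) = φ x) : IsPeriodic φ := by
  have hnat : ∀ (x : ℚ) (n : ℕ), φ (x + n) = φ x := by
    intro x n
    induction n with
    | zero => simp
    | succ n ih => rw [Nat.cast_succ, ← add_assoc, hper, ih]
  intro r z
  obtain ⟨n, rfl | rfl⟩ := Int.eq_nat_or_neg z
  · exact_mod_cast hnat r n
  · have h := hnat (r + ((-(n : ℤ) : ℤ) : ℚ)) n
    rw [show r + ((-(n : ℤ) : ℤ) : ℚ) + (n : ℚ) = r by push_cast; ring] at h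
    exact h.symm

/-- A Hecke relation survives multiplication of the function by a constant. [folklore] -/
theorem heckeRel_const_mul {ν : ℚ → k} {q : ℕ} {a : k} (h : HeckeRel ν q a) (c : k) :
    HeckeRel (fun r ↦ c * ν r) q a := by
  intro r
  have := congrArg (fun x ↦ c * x) (h r)
  simp only [mul_add, Finset.mul_sum] at this
  simp only
  rw [this]
  ring

/-- The tree's reduction `ratModP (3^1) x` of a rational IS its cast into the field `ℤ/3` (`x.num · x.den⁻¹`;
`ℤ/3^1 = ℤ/3` definitionally). [folklore] -/
theorem ratModP_three_pow_one_eq_ratCast (x : ℚ) :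
    ratModP (3 ^ 1) x = (haveI : Fact (Nat.Prime 3) := ⟨Nat.prime_three⟩; ((x : ℚ) : ZMod 3)) := by
  haveI : Fact (Nat.Prime 3) := ⟨Nat.prime_three⟩
  rw [Rat.cast_def, div_eq_mul_inv]
  rfl

/-- **(LL_1) at `q`, read in `k` through `π : ℤ/3 →+* k`, IMPLIES cell b2b-bsdres' certificate
`PlusSymbolLevelLowersOver W 3 f π q`.** Take `μ = u·φ`: `1`-periodic; `T_ℓ`-eigen with eigenvalue
`π(a_ℓ(E) mod 3)` at every Kolyvagin prime `ℓ` of `(W, 3)` (a Kolyvagin prime is a good prime `∤ 3N_E`, where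
(LL_1) supplies the relation); and `π([r]⁺_f mod 3) = μ(r) − μ(qr)` (`ratModP (3^1) = (· : ℤ/3)`). The converse
fails in general: (LL_1) is the STRONGER typed input. [cite: GreenbergVatsal2000, §3 display (18)–(19)]
[cite: MazurTateTeitelbaum1986Invent, §I.4 (4.2)] [cite: Kim2022StructureSelmer, §1.2.2 and §1.4.3] -/
theorem plusSymbolLevelLowersOver_three_of_isStabilisedLevelLoweringCongruenceIn
    (W : WeierstrassCurve ℚ) [W.IsGloballyMinimal] {N : ℕ} (f : CuspForm (Gamma0 N) 2) (q : ℕ)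
    (π : ZMod 3 →+* k)
    (hLL : IsStabilisedLevelLoweringCongruenceIn W 3 1 f q π) :
    (haveI : Fact (Nat.Prime 3) := ⟨Nat.prime_three⟩; PlusSymbolLevelLowersOver W 3 f π q) := by
  haveI : Fact (Nat.Prime 3) := ⟨Nat.prime_three⟩
  obtain ⟨u, φ, hper, hH, hC⟩ := hLL
  refine ⟨fun r ↦ u * φ r, fun r z ↦ ?_, fun ℓ hℓ ↦ ?_, fun r ↦ ?_⟩
  · simp only [isPeriodic_of_forall_add_one hper r z]
  · have hφ : HeckeRel φ ℓ (π (W.frobeniusTrace ℓ : ZMod 3)) := by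
      intro r
      rw [map_intCast, hH ℓ hℓ.prime hℓ.not_dvd r, ← Fin.sum_univ_eq_sum_range]
    exact heckeRel_const_mul hφ u
  · have h := hC r
    rw [ratModP_three_pow_one_eq_ratCast] at h
    rw [h]
    ring

/-- **(LL_1) over `ℤ/3` itself IMPLIES the `ℤ/3`-valued certificate `PlusSymbolLevelLowersAt W 3 f q`.**
[cite: GreenbergVatsal2000, §3 display (18)–(19)] [cite: Kim2022StructureSelmer, §1.2.2 and §1.4.3] -/
theorem plusSymbolLevelLowersAt_three_of_isStabilisedLevelLoweringCongruence
    (W : WeierstrassCurve ℚ) [W.IsGloballyMinimal] {N : ℕ} (f : CuspForm (Gamma0 N) 2) (q : ℕ)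
    (hLL : IsStabilisedLevelLoweringCongruence W 3 1 f q) :
    (haveI : Fact (Nat.Prime 3) := ⟨Nat.prime_three⟩; PlusSymbolLevelLowersAt W 3 f q) := by
  haveI : Fact (Nat.Prime 3) := ⟨Nat.prime_three⟩
  rw [← plusSymbolLevelLowersOver_id_iff]
  exact plusSymbolLevelLowersOver_three_of_isStabilisedLevelLoweringCongruenceIn W f q (RingHom.id (ZMod 3))
    (hLL.map (RingHom.id _))

end Comparison

/-! ### §2 The registered stub, re-keyed to `IsStabilisedLevelLoweringCongruence` -/

section Rows

variable {k : Type*} [CommRing k] [Nontrivial k]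

/-- ★ **`stub_nonAdditive` on its COVERED rows with `v₃(∏ c_ℓ) ≤ m` from (LL_m) under its Literature NAME**:
binders verbatim, then «ordinary if good, (ram) if multiplicative», `v₃(∏ c_ℓ) ≤ m`, and
`IsStabilisedLevelLoweringCongruence W₀ 3 m D₀.f q` at some `q ∣ 3N_E`; SIX named facts (`hYZ hW20 hSk hmod hGZK
hM`). The (TD) binder of gen 0's `stub_nonAdditive_covered_of_tamagawa_le_deepInfty` is fed by the owner's
`tamagawa_le_kuriharaPartialInfty_of_stabilisedCongruence`. [cite: YanZhu2024MainConjNonCM, Thm. 4.15 (§4.6)]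
[cite: Skinner2016PacificMC, Thm. C (§1)] [cite: Mazur1978, Cor. 4.1] [cite: Kim2025RefinedTNC, §8.1.2]
[cite: GreenbergVatsal2000, §3 display (18)–(19)] -/
theorem stub_nonAdditive_covered_of_isStabilisedLevelLoweringCongruence
    (hYZ : YanZhu2026.thm415_padicValRat_bsd_rank_le_one)
    (hW20 : Wuthrich2014.lemma20_surjective_threeAdic_of_semistable)
    (hSk : Skinner2016.thmC_padicValRat_bsd_rank_zero)
    (hmod : hasEntireLFunction_rat) (hGZK : rank_eq_analyticRank_of_analyticRank_le_one)
    (hM : mazur_not_dvd_maninConstant_of_odd) :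
    ∀ (W₀ : WeierstrassCurve ℚ) [W₀.IsElliptic] [W₀.IsGloballyMinimal],
      (∀ n : ℕ, W₀.HasSurjectiveModNGaloisRep (3 ^ n : ℕ)) → Finite W₀.sha →
      ∀ {N : ℕ} [NeZero N], N = W₀.conductorNorm ℤ →
      ∀ (D₀ : ModularParametrizationData W₀ N),
        (∀ z ∈ D₀.L.lattice, ∃ w ∈ periodLattice D₀.f, z = D₀.c * w) →
        (∀ (W₂ : WeierstrassCurve ℚ) [W₂.IsElliptic] (D₂ : ModularParametrizationData W₂ N),
          D₂.f = D₀.f → D₀.modularDegree ≤ D₂.modularDegree) →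
        (∀ r : ℚ, ratPlusSymbol D₀.f r ≠ 0 → 0 ≤ padicValRat 3 (ratPlusSymbol D₀.f r)) →
        kuriharaVanishingOrder W₀ 3 D₀.f = 0 →
        ¬ (haveI : Fact (Nat.Prime 3) := ⟨Nat.prime_three⟩; Addv W₀ 3) →
        (W₀.HasGoodReductionAtPrime 3 → ¬ (3 : ℤ) ∣ W₀.frobeniusTrace 3) →
        (W₀.HasMultiplicativeReductionAtPrime 3 →
          (haveI : Fact (Nat.Prime 3) := ⟨Nat.prime_three⟩; Ram W₀ 3)) →
        ∀ m : ℕ, padicValNat 3 W₀.tamagawaProduct ≤ m →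
        ∀ q : ℕ, q ∣ W₀.conductorNorm ℤ * 3 → IsStabilisedLevelLoweringCongruence W₀ 3 m D₀.f q →
        ∃ d : ℕ, kuriharaPartialDeepInfty W₀ 3 D₀.f = d ∧
          kuriharaPartial W₀ 3 D₀.f 0 ≤
            ((padicValNat 3 (Nat.card (AddCommGroup.primaryComponent W₀.sha 3)) + d : ℕ) : ℕ∞) := by
  intro W₀ _ _ htower hfin N _ hN D₀ hopt hdeg hint hord hnA hordinary hram m hv q hq hLL
  haveI : Fact (Nat.Prime 3) := ⟨Nat.prime_three⟩
  obtain ⟨u, φ, hper, hφH, hC⟩ := hLL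
  exact stub_nonAdditive_covered_of_tamagawa_le_deepInfty hYZ hW20 hSk hmod hGZK hM W₀ htower hfin hN D₀ hopt
    hdeg hint hord hnA hordinary hram (fun _ =>
      (tamagawa_le_kuriharaPartialInfty_of_stabilisedCongruence W₀ 3 m D₀.f hint hv q hq u φ hper hφH hC).2)

/-- ★ **The same on the SEMISTABLE rows** (no (ram), no Yan–Zhu binder; `hSk hmod hGZK hM hBCDT hLL'`): this
seat's `stub_nonAdditive_semistable_of_skinner_of_stabilisedCongruence` re-keyed. [cite: Skinner2016PacificMC, Thm. C (§1)]
[cite: Ribet1990, Thm. 1.1] [cite: Mazur1978, Cor. 4.1] [cite: GreenbergVatsal2000, §3 display (18)–(19)] -/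
theorem stub_nonAdditive_semistable_of_isStabilisedLevelLoweringCongruence
    (hSk : Skinner2016.thmC_padicValRat_bsd_rank_zero)
    (hmod : hasEntireLFunction_rat) (hGZK : rank_eq_analyticRank_of_analyticRank_le_one)
    (hM : mazur_not_dvd_maninConstant_of_odd)
    (hBCDT : exists_isNewformOf) (hLL' : diamond1995_refinedSerre) :
    ∀ (W₀ : WeierstrassCurve ℚ) [W₀.IsElliptic] [W₀.IsGloballyMinimal],
      (∀ n : ℕ, W₀.HasSurjectiveModNGaloisRep (3 ^ n : ℕ)) → Finite W₀.sha →
      ∀ {N : ℕ} [NeZero N], N = W₀.conductorNorm ℤ →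
      ∀ (D₀ : ModularParametrizationData W₀ N),
        (∀ z ∈ D₀.L.lattice, ∃ w ∈ periodLattice D₀.f, z = D₀.c * w) →
        (∀ (W₂ : WeierstrassCurve ℚ) [W₂.IsElliptic] (D₂ : ModularParametrizationData W₂ N),
          D₂.f = D₀.f → D₀.modularDegree ≤ D₂.modularDegree) →
        (∀ r : ℚ, ratPlusSymbol D₀.f r ≠ 0 → 0 ≤ padicValRat 3 (ratPlusSymbol D₀.f r)) →
        kuriharaVanishingOrder W₀ 3 D₀.f = 0 →
        ¬ (haveI : Fact (Nat.Prime 3) := ⟨Nat.prime_three⟩; Addv W₀ 3) →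
        Semistable W₀ →
        (W₀.HasGoodReductionAtPrime 3 → ¬ (3 : ℤ) ∣ W₀.frobeniusTrace 3) →
        ∀ m : ℕ, padicValNat 3 W₀.tamagawaProduct ≤ m →
        ∀ q : ℕ, q ∣ W₀.conductorNorm ℤ * 3 → IsStabilisedLevelLoweringCongruence W₀ 3 m D₀.f q →
        ∃ d : ℕ, kuriharaPartialDeepInfty W₀ 3 D₀.f = d ∧
          kuriharaPartial W₀ 3 D₀.f 0 ≤
            ((padicValNat 3 (Nat.card (AddCommGroup.primaryComponent W₀.sha 3)) + d : ℕ) : ℕ∞) := by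
  intro W₀ _ _ htower hfin N _ hN D₀ hopt hdeg hint hord hnA hsst hordinary m hv q hq hLL
  obtain ⟨u, φ, hper, hφH, hC⟩ := hLL
  exact stub_nonAdditive_semistable_of_skinner_of_stabilisedCongruence hSk hmod hGZK hM hBCDT hLL' W₀ htower hfin
    hN D₀ hopt hdeg hint hord hnA hsst hordinary m hv q hq u φ hper hφH hC

/-- ★ **`stub_nonAdditive` on its COVERED rows with `v₃(∏ c_ℓ) ≤ 1` from the `k`-VALUED (LL_1)
(`IsStabilisedLevelLoweringCongruenceIn W₀ 3 1 D₀.f q π`, `q ∣ N_E`) — THROUGH cell b2b-bsdres' certificate** (§1 +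
`KimAtThreeDeepLowerOffStratumLevelLoweringBridge.stub_nonAdditive_covered_of_plusSymbolLevelLowersOver`); this is
the owner's field-valued road (p460203) factored through the older typed input. [cite: YanZhu2024MainConjNonCM, Thm. 4.15 (§4.6)]
[cite: Skinner2016PacificMC, Thm. C (§1)] [cite: Mazur1978, Cor. 4.1] [cite: Ribet1990, Thm. 1.1 and Thm. 5.2 (b)]
[cite: GreenbergVatsal2000, §3 display (18)–(19)] -/
theorem stub_nonAdditive_covered_of_isStabilisedLevelLoweringCongruenceIn
    (hYZ : YanZhu2026.thm415_padicValRat_bsd_rank_le_one)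
    (hW20 : Wuthrich2014.lemma20_surjective_threeAdic_of_semistable)
    (hSk : Skinner2016.thmC_padicValRat_bsd_rank_zero)
    (hmod : hasEntireLFunction_rat) (hGZK : rank_eq_analyticRank_of_analyticRank_le_one)
    (hM : mazur_not_dvd_maninConstant_of_odd) :
    ∀ (W₀ : WeierstrassCurve ℚ) [W₀.IsElliptic] [W₀.IsGloballyMinimal],
      (∀ n : ℕ, W₀.HasSurjectiveModNGaloisRep (3 ^ n : ℕ)) → Finite W₀.sha →
      ∀ {N : ℕ} [NeZero N], N = W₀.conductorNorm ℤ →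
      ∀ (D₀ : ModularParametrizationData W₀ N),
        (∀ z ∈ D₀.L.lattice, ∃ w ∈ periodLattice D₀.f, z = D₀.c * w) →
        (∀ (W₂ : WeierstrassCurve ℚ) [W₂.IsElliptic] (D₂ : ModularParametrizationData W₂ N),
          D₂.f = D₀.f → D₀.modularDegree ≤ D₂.modularDegree) →
        (∀ r : ℚ, ratPlusSymbol D₀.f r ≠ 0 → 0 ≤ padicValRat 3 (ratPlusSymbol D₀.f r)) →
        kuriharaVanishingOrder W₀ 3 D₀.f = 0 →
        ¬ (haveI : Fact (Nat.Prime 3) := ⟨Nat.prime_three⟩; Addv W₀ 3) →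
        (W₀.HasGoodReductionAtPrime 3 → ¬ (3 : ℤ) ∣ W₀.frobeniusTrace 3) →
        (W₀.HasMultiplicativeReductionAtPrime 3 →
          (haveI : Fact (Nat.Prime 3) := ⟨Nat.prime_three⟩; Ram W₀ 3)) →
        padicValNat 3 W₀.tamagawaProduct ≤ 1 →
        ∀ (π : ZMod 3 →+* k) (q : ℕ), q ∣ W₀.conductorNorm ℤ →
          IsStabilisedLevelLoweringCongruenceIn W₀ 3 1 D₀.f q π →
        ∃ d : ℕ, kuriharaPartialDeepInfty W₀ 3 D₀.f = d ∧
          kuriharaPartial W₀ 3 D₀.f 0 ≤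
            ((padicValNat 3 (Nat.card (AddCommGroup.primaryComponent W₀.sha 3)) + d : ℕ) : ℕ∞) := by
  intro W₀ _ _ htower hfin N _ hN D₀ hopt hdeg hint hord hnA hordinary hram hv π q hq hLL
  exact stub_nonAdditive_covered_of_plusSymbolLevelLowersOver hYZ hW20 hSk hmod hGZK hM W₀ htower hfin hN D₀
    hopt hdeg hint hord hnA hordinary hram hv π q hq
    (plusSymbolLevelLowersOver_three_of_isStabilisedLevelLoweringCongruenceIn W₀ D₀.f q π hLL)

/-- ★ **The same on the SEMISTABLE rows** (`hSk hmod hGZK hM hBCDT hLL'` + the `k`-valued (LL_1) at `q ∣ N_E`).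
[cite: Skinner2016PacificMC, Thm. C (§1)] [cite: Ribet1990, Thm. 1.1 and Thm. 5.2 (b)] [cite: Mazur1978, Cor. 4.1]
[cite: GreenbergVatsal2000, §3 display (18)–(19)] -/
theorem stub_nonAdditive_semistable_of_isStabilisedLevelLoweringCongruenceIn
    (hSk : Skinner2016.thmC_padicValRat_bsd_rank_zero)
    (hmod : hasEntireLFunction_rat) (hGZK : rank_eq_analyticRank_of_analyticRank_le_one)
    (hM : mazur_not_dvd_maninConstant_of_odd)
    (hBCDT : exists_isNewformOf) (hLL' : diamond1995_refinedSerre) :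
    ∀ (W₀ : WeierstrassCurve ℚ) [W₀.IsElliptic] [W₀.IsGloballyMinimal],
      (∀ n : ℕ, W₀.HasSurjectiveModNGaloisRep (3 ^ n : ℕ)) → Finite W₀.sha →
      ∀ {N : ℕ} [NeZero N], N = W₀.conductorNorm ℤ →
      ∀ (D₀ : ModularParametrizationData W₀ N),
        (∀ z ∈ D₀.L.lattice, ∃ w ∈ periodLattice D₀.f, z = D₀.c * w) →
        (∀ (W₂ : WeierstrassCurve ℚ) [W₂.IsElliptic] (D₂ : ModularParametrizationData W₂ N),
          D₂.f = D₀.f → D₀.modularDegree ≤ D₂.modularDegree) →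
        (∀ r : ℚ, ratPlusSymbol D₀.f r ≠ 0 → 0 ≤ padicValRat 3 (ratPlusSymbol D₀.f r)) →
        kuriharaVanishingOrder W₀ 3 D₀.f = 0 →
        ¬ (haveI : Fact (Nat.Prime 3) := ⟨Nat.prime_three⟩; Addv W₀ 3) →
        Semistable W₀ →
        (W₀.HasGoodReductionAtPrime 3 → ¬ (3 : ℤ) ∣ W₀.frobeniusTrace 3) →
        padicValNat 3 W₀.tamagawaProduct ≤ 1 →
        ∀ (π : ZMod 3 →+* k) (q : ℕ), q ∣ W₀.conductorNorm ℤ →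
          IsStabilisedLevelLoweringCongruenceIn W₀ 3 1 D₀.f q π →
        ∃ d : ℕ, kuriharaPartialDeepInfty W₀ 3 D₀.f = d ∧
          kuriharaPartial W₀ 3 D₀.f 0 ≤
            ((padicValNat 3 (Nat.card (AddCommGroup.primaryComponent W₀.sha 3)) + d : ℕ) : ℕ∞) := by
  intro W₀ _ _ htower hfin N _ hN D₀ hopt hdeg hint hord hnA hsst hordinary hv π q hq hLL
  exact stub_nonAdditive_semistable_of_plusSymbolLevelLowersOver hSk hmod hGZK hM hBCDT hLL' W₀ htower hfin hN D₀
    hopt hdeg hint hord hnA hsst hordinary hv π q hq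
    (plusSymbolLevelLowersOver_three_of_isStabilisedLevelLoweringCongruenceIn W₀ D₀.f q π hLL)

end Rows

end Summit.BirchSwinnertonDyer.BirchSwinnertonDyer.Theorems.KimAtThreeDeepLowerOffStratumLevelLoweringRekey

end
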